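import Mathlib.Analysis.Normed.Module.Basic
import Mathlib.Analysis.Normed.Module.RCLike.Real
import HarnessLib

/-!
# Injectivity of polar-graph maps `(ρ, u) ↦ R(ρ, u) Θ(ρ, u)` (shell lemma)

Topic `Geometry/Riemannian` (an elementary lemma on normed spaces). In the interior surgery of
Weinstein's disk (Weinstein 1968, proof of the main theorem, step (3): a metric on the disk for
which the geodesics from the centre reach the boundary sphere orthogonally at the same time) the
radial map is assembled in "polar-graph" form `F(ρ u) = R(ρ, u) Θ(ρ, u)` with a radial function
`R > 0` and a direction field `Θ` (`‖Θ‖ = 1`): on the collar it is the cone map of the sphere, whose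
directions drift with `ρ`, and towards the centre the drift is unwound to the identity. This file
isolates the elementary reason why such a map is injective — **radial growth dominates angular
drift** — with finite-difference hypotheses (no inversion of `Θ(ρ, ·)` is needed):

* `injOn_polarGraph` — if `u ↦ Θ(ρ, u)` is `m`-co-Lipschitz, `ρ ↦ Θ(ρ, u)` is `A`-Lipschitz,
  `R(ρ', u') - R(ρ, u) ≥ μ (ρ' - ρ) - B ‖u - u'‖` for `ρ ≤ ρ'`, and `A B < μ m`, then
  `(ρ, u) ↦ R(ρ, u) Θ(ρ, u)` is injective on `J × S`.

Proof: equal images have equal norms `R(ρ, u) = R(ρ', u')` and equal directions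
`Θ(ρ, u) = Θ(ρ', u')`; for `ρ ≤ ρ'`, `m‖u - u'‖ ≤ ‖Θ(ρ, u) - Θ(ρ, u')‖ = ‖Θ(ρ', u') - Θ(ρ, u')‖ ≤ A(ρ' - ρ)`
and `0 = R(ρ', u') - R(ρ, u) ≥ (μ - AB/m)(ρ' - ρ)`, so `ρ = ρ'` and then `u = u'`.

## References

* A. Weinstein, *The cut locus and conjugate locus of a Riemannian manifold*, Ann. of Math. (2)
  87 (1968), 29–41, proof of the main theorem, step (3). [cite: Weinstein1968]

Tags: [PolarGraph] [Injectivity] [Weinstein1968]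
-/

noncomputable section

open Set Function

namespace Literature.Geometry.Riemannian

variable {V : Type*} [NormedAddCommGroup V] [NormedSpace ℝ V]

/-- **Shell lemma: radial growth dominates angular drift.** Let `R : ℝ → V → ℝ` be positive and
`Θ : ℝ → V → V` unit-valued on `J × S`, with: `u ↦ Θ(ρ, u)` `m`-co-Lipschitz on `S`,
`ρ ↦ Θ(ρ, u)` `A`-Lipschitz on `J`, and `R(ρ', u') - R(ρ, u) ≥ μ(ρ' - ρ) - B‖u - u'‖` for
`ρ ≤ ρ'` in `J`, `u, u' ∈ S`, where `m > 0`, `B ≥ 0` and `A B < μ m`. Then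
`(ρ, u) ↦ R(ρ, u) • Θ(ρ, u)` is injective on `J ×ˢ S`.
[cite: Weinstein1968, proof of the main theorem, step (3)] -/
theorem injOn_polarGraph {R : ℝ → V → ℝ} {Θ : ℝ → V → V} {J : Set ℝ} {S : Set V}
    {m A μ B : ℝ} (hm : 0 < m) (hB : 0 ≤ B) (hdom : A * B < μ * m)
    (hΘnorm : ∀ ρ ∈ J, ∀ u ∈ S, ‖Θ ρ u‖ = 1) (hRpos : ∀ ρ ∈ J, ∀ u ∈ S, 0 < R ρ u)
    (hΘinj : ∀ ρ ∈ J, ∀ u ∈ S, ∀ u' ∈ S, m * ‖u - u'‖ ≤ ‖Θ ρ u - Θ ρ u'‖)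
    (hΘρ : ∀ ρ ∈ J, ∀ ρ' ∈ J, ∀ u ∈ S, ‖Θ ρ u - Θ ρ' u‖ ≤ A * |ρ - ρ'|)
    (hR : ∀ ρ ∈ J, ∀ ρ' ∈ J, ρ ≤ ρ' → ∀ u ∈ S, ∀ u' ∈ S,
      μ * (ρ' - ρ) - B * ‖u - u'‖ ≤ R ρ' u' - R ρ u) :
    InjOn (fun q : ℝ × V ↦ R q.1 q.2 • Θ q.1 q.2) (J ×ˢ S) := by
  -- the one-sided statement
  have key : ∀ ρ ∈ J, ∀ ρ' ∈ J, ρ ≤ ρ' → ∀ u ∈ S, ∀ u' ∈ S,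
      R ρ u • Θ ρ u = R ρ' u' • Θ ρ' u' → ρ = ρ' ∧ u = u' := by
    intro ρ hρ ρ' hρ' hle u hu u' hu' heq
    -- equal norms
    have hn : R ρ u = R ρ' u' := by
      have h := congrArg norm heq
      rw [norm_smul, norm_smul, hΘnorm ρ hρ u hu, hΘnorm ρ' hρ' u' hu', mul_one, mul_one,
        Real.norm_eq_abs, Real.norm_eq_abs, abs_of_pos (hRpos ρ hρ u hu),
        abs_of_pos (hRpos ρ' hρ' u' hu')] at h
      exact h
    -- equal directions
    have hd : Θ ρ u = Θ ρ' u' := by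
      rw [hn] at heq
      exact smul_right_injective V (hRpos ρ' hρ' u' hu').ne' heq
    -- `m ‖u - u'‖ ≤ A (ρ' - ρ)`
    have h1 : m * ‖u - u'‖ ≤ A * (ρ' - ρ) := by
      have h2 := hΘinj ρ hρ u hu u' hu'
      rw [hd] at h2
      have h3 := hΘρ ρ' hρ' ρ hρ u' hu'
      rw [abs_of_nonneg (sub_nonneg.2 hle)] at h3
      exact h2.trans h3
    -- `0 = R(ρ', u') - R(ρ, u) ≥ μ (ρ' - ρ) - B ‖u - u'‖`
    have h4 : μ * (ρ' - ρ) - B * ‖u - u'‖ ≤ 0 := by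
      have := hR ρ hρ ρ' hρ' hle u hu u' hu'
      rw [hn, sub_self] at this
      exact this
    -- hence `ρ = ρ'`
    have h5 : ρ' - ρ = 0 := by
      by_contra hne
      have hpos : 0 < ρ' - ρ := lt_of_le_of_ne (sub_nonneg.2 hle) (Ne.symm hne)
      -- `m μ (ρ' - ρ) ≤ m B ‖u - u'‖ ≤ B A (ρ' - ρ)`
      have h6 : m * (μ * (ρ' - ρ)) ≤ B * (A * (ρ' - ρ)) := by
        calc m * (μ * (ρ' - ρ)) ≤ m * (B * ‖u - u'‖) := by
              apply mul_le_mul_of_nonneg_left _ hm.le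
              linarith
          _ = B * (m * ‖u - u'‖) := by ring
          _ ≤ B * (A * (ρ' - ρ)) := mul_le_mul_of_nonneg_left h1 hB
      have h7 : μ * m ≤ A * B := by
        have := (mul_le_mul_iff_of_pos_right hpos).1 (by nlinarith [h6] : (μ * m) * (ρ' - ρ) ≤ (A * B) * (ρ' - ρ))
        exact this
      linarith
    have hρeq : ρ = ρ' := by linarith
    refine ⟨hρeq, ?_⟩
    -- and `u = u'`
    have h8 : m * ‖u - u'‖ ≤ 0 := by rw [h5, mul_zero] at h1; exact h1
    have h9 : ‖u - u'‖ ≤ 0 := by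
      by_contra hne
      have : 0 < ‖u - u'‖ := lt_of_not_ge hne
      nlinarith
    exact sub_eq_zero.1 (norm_le_zero_iff.1 h9)
  -- symmetrise
  rintro ⟨ρ, u⟩ ⟨hρ, hu⟩ ⟨ρ', u'⟩ ⟨hρ', hu'⟩ heq
  rcases le_total ρ ρ' with hle | hle
  · obtain ⟨h1, h2⟩ := key ρ hρ ρ' hρ' hle u hu u' hu' heq
    rw [h1, h2]
  · obtain ⟨h1, h2⟩ := key ρ' hρ' ρ hρ hle u' hu' u hu heq.symm
    rw [h1, h2]

end Literature.Geometry.Riemannian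

end
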